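import Mathlib.Analysis.SpecialFunctions.Log.Base
import Mathlib.Logic.Equiv.Fin.Basic
import Literature.Computability.AlgebraicComplexity.MatrixMultiplicationExponent
import Literature.Computability.AlgebraicComplexity.AsymptoticSpectrum
import Literature.Computability.AlgebraicComplexity.TensorRankFacts
import Literature.Computability.AlgebraicComplexity.FlatteningBound
import HarnessLib

/-!
# Rank under Kronecker products and permutations; matrix tensors multiply (Bläser 2013, §5) — proved

Topic `Literature/Computability/AlgebraicComplexity`; cite item `wi-04435` (MatrixMultiplication
survey).  Everything in this file is PROVED (elementary index bookkeeping over a commutative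
semiring); the statements are those of M. Bläser, *Fast Matrix Multiplication*, Theory of
Computing Graduate Surveys 5 (2013) (held: `paper:doi-10-4086-toc-gs-2013-005`), §5:

* Lemma 5.3 (p. 20) `R(t) = R(πt)` (permuting the three dimensions) — `tensorRank_swap₂₃` (the
  cyclic case `tensorRank_rotate` is in `FlatteningBound.lean`); Lemma 5.4, equality case (p. 21: "Equality holds if `A, B, C` are
  isomorphisms") for coordinate relabellings — `tensorRank_reindex`;
* Lemma 5.5 (p. 22) `R(⟨k,m,n⟩) = R(⟨n,k,m⟩) = R(⟨m,n,k⟩) = R(⟨m,k,n⟩) = R(⟨n,m,k⟩) = R(⟨k,n,m⟩)` —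
  `tensorRank_matMulTensor_rotate`, `tensorRank_matMulTensor_transpose`, `Blaser2013_lemma55`;
* Lemma 5.8 (p. 23) `R(t ⊗ t') ≤ R(t) R(t')` — `Blaser2013_lemma58` (Kronecker product
  `kroneckerTensor` of `AsymptoticSpectrum.lean`; general index types, any commutative semiring —
  the square matrix case is also proved problem-side in
  `Summits/MatrixMultiplication/…/Theorems/AsymptoticSpectrumKronecker.lean`);
* p. 24: "the tensor product of two matrix tensors is a bigger matrix tensor",
  `⟨k,m,n⟩ ⊗ ⟨k',m',n'⟩ ≅ ⟨kk',mm',nn'⟩` (double indices ↔ `finProdFinEquiv`) —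
  `kroneckerTensor_matMulTensor`, whence `Blaser2013_rank_matMulTensor_mul_le :
  R(⟨kk',mm',nn'⟩) ≤ R(⟨k,m,n⟩) R(⟨k',m',n'⟩)` and the DISCHARGE `Blaser2013RankSubmult_holds` of the
  named fact of `TensorRankFacts.lean`;
* Thm 5.9 (p. 24) in the cubic format: `R(⟨n,n,n⟩) ≤ r ⇒ ω ≤ log_n r` — `omega_le_logb_of_rank_le'`
  (from the named fact `Blaser2013Thm59`, `3 log_{n³} r = log_n r`).

(Bürgisser–Clausen–Shokrollahi 1997, Prop. 14.23 and (15.1) print the same statements.)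
-/

noncomputable section

open scoped BigOperators

namespace Literature.Computability.AlgebraicComplexity

universe u

variable {K : Type u} [CommSemiring K]

section General

variable {ι κ μ ι' κ' μ' : Type*}

/-- Entries of a sum of triads. [folklore] -/
theorem sum_triad_apply {r : ℕ} (w : Fin r → ι → K) (u : Fin r → κ → K)
    (v : Fin r → μ → K) (a : ι) (b : κ) (c : μ) :
    (∑ i, triad (w i) (u i) (v i)) a b c = ∑ i, w i a * u i b * v i c := by
  rw [Finset.sum_apply, Finset.sum_apply, Finset.sum_apply]
  simp only [triad_apply]

/-- **Rank is invariant under relabelling the coordinates** (Bläser 2013, Lemma 5.4, equality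
case for isomorphisms — here coordinate bijections). [cite: Blaser2013, Lemma 5.4] -/
theorem tensorRank_reindex (eι : ι' ≃ ι) (eκ : κ' ≃ κ) (eμ : μ' ≃ μ) (t : ι → κ → μ → K) :
    tensorRank (fun a b c => t (eι a) (eκ b) (eμ c)) = tensorRank t := by
  unfold tensorRank
  congr 1
  ext r
  constructor
  · rintro ⟨w, u, v, h⟩
    refine ⟨fun i a => w i (eι.symm a), fun i b => u i (eκ.symm b), fun i c => v i (eμ.symm c), ?_⟩
    funext a b c
    have := congrFun (congrFun (congrFun h (eι.symm a)) (eκ.symm b)) (eμ.symm c)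
    simp only [Equiv.apply_symm_apply] at this
    rw [this, sum_triad_apply, sum_triad_apply]
  · rintro ⟨w, u, v, h⟩
    refine ⟨fun i a => w i (eι a), fun i b => u i (eκ b), fun i c => v i (eμ c), ?_⟩
    funext a b c
    rw [h, sum_triad_apply, sum_triad_apply]

/-- **Rank is invariant under swapping the last two factors** (Bläser 2013, Lemma 5.3).
[cite: Blaser2013, Lemma 5.3] -/
theorem tensorRank_swap₂₃ (t : ι → κ → μ → K) :
    tensorRank (fun a c b => t a b c) = tensorRank t := by
  unfold tensorRank
  congr 1
  ext r
  constructor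
  · rintro ⟨w, v, u, h⟩
    refine ⟨w, u, v, ?_⟩
    funext a b c
    have := congrFun (congrFun (congrFun h a) c) b
    rw [sum_triad_apply] at this
    rw [this, sum_triad_apply]
    exact Finset.sum_congr rfl fun i _ => by ring
  · rintro ⟨w, u, v, h⟩
    refine ⟨w, v, u, ?_⟩
    funext a c b
    rw [h, sum_triad_apply, sum_triad_apply]
    exact Finset.sum_congr rfl fun i _ => by ring

/-- **Bläser 2013, Lemma 5.8: rank is submultiplicative under the tensor (Kronecker) product**,
`R(t ⊗ t') ≤ R(t) · R(t')` (finite index types). [cite: Blaser2013, Lemma 5.8] -/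
theorem Blaser2013_lemma58 [Fintype ι] [Fintype κ] [Fintype μ] [Fintype ι'] [Fintype κ']
    [Fintype μ'] (s : ι → κ → μ → K) (t : ι' → κ' → μ' → K) :
    tensorRank (kroneckerTensor s t) ≤ tensorRank s * tensorRank t := by
  obtain ⟨w, u, v, hs⟩ := exists_triad_decomposition_tensorRank s
  obtain ⟨w', u', v', ht⟩ := exists_triad_decomposition_tensorRank t
  have hcard : Fintype.card (Fin (tensorRank s) × Fin (tensorRank t)) = tensorRank s * tensorRank t := by
    simp
  rw [← hcard]
  refine tensorRank_le_card_of_eq_sum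
    (fun p a => w p.1 a.1 * w' p.2 a.2) (fun p b => u p.1 b.1 * u' p.2 b.2)
    (fun p c => v p.1 c.1 * v' p.2 c.2) ?_
  funext a b c
  rw [Finset.sum_apply, Finset.sum_apply, Finset.sum_apply, kroneckerTensor_apply]
  simp only [triad_apply]
  conv_lhs => rw [hs, ht]
  rw [sum_triad_apply, sum_triad_apply, Finset.sum_mul_sum, Fintype.sum_prod_type]
  refine Finset.sum_congr rfl fun i _ => Finset.sum_congr rfl fun j _ => ?_
  ring

end General

/-! ### Matrix multiplication tensors -/

section MatMul

variable (K)

/-- Rotating the factors of `⟨k,m,n⟩` gives `⟨m,n,k⟩` up to swapping the coordinates of the first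
and third index sets (`(κ,μ) ↔ (μ,κ)`, `(κ,ν) ↔ (ν,κ)`) (Bläser 2013, p. 22, first
transformation). [cite: Blaser2013, Lemma 5.5 (proof, p. 22)] -/
theorem matMulTensor_rotate (k m n : ℕ) (b : Fin k × Fin m) (c : Fin m × Fin n) (a : Fin k × Fin n) :
    matMulTensor K k m n a b c = matMulTensor K m n k b.swap c a.swap := by
  obtain ⟨κ, μ⟩ := b; obtain ⟨μ', ν⟩ := c; obtain ⟨κ', ν'⟩ := a
  simp only [matMulTensor, Prod.swap_prod_mk]
  exact if_congr ⟨fun ⟨h1, h2, h3⟩ => ⟨h2, h3.symm, h1.symm⟩, fun ⟨h2, h3, h1⟩ => ⟨h1.symm, h2, h3.symm⟩⟩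
    rfl rfl

/-- Transposition `(XY)ᵀ = YᵀXᵀ`: swapping the last two factors of `⟨k,m,n⟩` gives `⟨n,m,k⟩` up to
swapping coordinates in each index set (Bläser 2013, p. 22, second transformation).
[cite: Blaser2013, Lemma 5.5 (proof, p. 22)] -/
theorem matMulTensor_transpose (k m n : ℕ) (a : Fin k × Fin n) (c : Fin m × Fin n) (b : Fin k × Fin m) :
    matMulTensor K k m n a b c = matMulTensor K n m k a.swap c.swap b.swap := by
  obtain ⟨κ, μ⟩ := b; obtain ⟨μ', ν⟩ := c; obtain ⟨κ', ν'⟩ := a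
  simp only [matMulTensor, Prod.swap_prod_mk]
  exact if_congr ⟨fun ⟨h1, h2, h3⟩ => ⟨h3, h2.symm, h1⟩, fun ⟨h3, h2, h1⟩ => ⟨h1, h2.symm, h3⟩⟩
    rfl rfl

/-- **`R(⟨k,m,n⟩) = R(⟨m,n,k⟩)`** (Bläser 2013, Lemma 5.5). [cite: Blaser2013, Lemma 5.5] -/
theorem tensorRank_matMulTensor_rotate (k m n : ℕ) :
    tensorRank (matMulTensor K k m n) = tensorRank (matMulTensor K m n k) := by
  rw [← tensorRank_rotate (matMulTensor K k m n)]
  have : rotate (matMulTensor K k m n) =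
      fun b c a => matMulTensor K m n k (Equiv.prodComm _ _ b) (Equiv.refl _ c) (Equiv.prodComm _ _ a) := by
    funext b c a
    rw [rotate_apply, matMulTensor_rotate]
    rfl
  rw [this, tensorRank_reindex]

/-- **`R(⟨k,m,n⟩) = R(⟨n,m,k⟩)`** (Bläser 2013, Lemma 5.5). [cite: Blaser2013, Lemma 5.5] -/
theorem tensorRank_matMulTensor_transpose (k m n : ℕ) :
    tensorRank (matMulTensor K k m n) = tensorRank (matMulTensor K n m k) := by
  rw [← tensorRank_swap₂₃ (matMulTensor K k m n)]
  have : (fun a c b => matMulTensor K k m n a b c) =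
      fun a c b => matMulTensor K n m k (Equiv.prodComm _ _ a) (Equiv.prodComm _ _ c)
        (Equiv.prodComm _ _ b) := by
    funext a c b
    rw [matMulTensor_transpose]
    rfl
  rw [this, tensorRank_reindex]

/-- **Bläser 2013, Lemma 5.5** as printed:
`R(⟨k,m,n⟩) = R(⟨n,k,m⟩) = R(⟨m,n,k⟩) = R(⟨m,k,n⟩) = R(⟨n,m,k⟩) = R(⟨k,n,m⟩)`.
[cite: Blaser2013, Lemma 5.5] -/
theorem Blaser2013_lemma55 (k m n : ℕ) :
    tensorRank (matMulTensor K k m n) = tensorRank (matMulTensor K n k m) ∧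
    tensorRank (matMulTensor K k m n) = tensorRank (matMulTensor K m n k) ∧
    tensorRank (matMulTensor K k m n) = tensorRank (matMulTensor K m k n) ∧
    tensorRank (matMulTensor K k m n) = tensorRank (matMulTensor K n m k) ∧
    tensorRank (matMulTensor K k m n) = tensorRank (matMulTensor K k n m) := by
  refine ⟨?_, tensorRank_matMulTensor_rotate K k m n, ?_, tensorRank_matMulTensor_transpose K k m n, ?_⟩
  · rw [tensorRank_matMulTensor_rotate, tensorRank_matMulTensor_rotate]
  · rw [tensorRank_matMulTensor_transpose, tensorRank_matMulTensor_rotate]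
  · rw [tensorRank_matMulTensor_rotate, tensorRank_matMulTensor_transpose]

/-- The double-index relabelling `(Fin k × Fin n) × (Fin k' × Fin n') ≃ Fin (k k') × Fin (n n')`
used to read `⟨k,m,n⟩ ⊗ ⟨k',m',n'⟩` as `⟨kk',mm',nn'⟩` (Bläser 2013, p. 23: "double indices `κ, κ'`
address the slices `1, …, kk'`"). [cite: Blaser2013, p. 23–24] -/
def doubleIndexEquiv (k n k' n' : ℕ) : (Fin k × Fin n) × (Fin k' × Fin n') ≃ Fin (k * k') × Fin (n * n') :=
  (Equiv.prodProdProdComm (Fin k) (Fin n) (Fin k') (Fin n')).trans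
    (Equiv.prodCongr finProdFinEquiv finProdFinEquiv)

/-- **Matrix tensors multiply**: `⟨k,m,n⟩ ⊗ ⟨k',m',n'⟩ = ⟨kk',mm',nn'⟩` after the double-index
relabelling ("the tensor product of two matrix tensors is a bigger matrix tensor",
`(A ⊗ B)(A' ⊗ B') = AA' ⊗ BB'`; Bläser 2013, p. 24). [cite: Blaser2013, §5.2 p. 24] -/
theorem kroneckerTensor_matMulTensor (k m n k' m' n' : ℕ) (a : (Fin k × Fin n) × (Fin k' × Fin n'))
    (b : (Fin k × Fin m) × (Fin k' × Fin m')) (c : (Fin m × Fin n) × (Fin m' × Fin n')) :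
    kroneckerTensor (matMulTensor K k m n) (matMulTensor K k' m' n') a b c =
      matMulTensor K (k * k') (m * m') (n * n') (doubleIndexEquiv k n k' n' a)
        (doubleIndexEquiv k m k' m' b) (doubleIndexEquiv m n m' n' c) := by
  obtain ⟨⟨a₁, a₂⟩, ⟨a₁', a₂'⟩⟩ := a
  obtain ⟨⟨b₁, b₂⟩, ⟨b₁', b₂'⟩⟩ := b
  obtain ⟨⟨c₁, c₂⟩, ⟨c₁', c₂'⟩⟩ := c
  simp only [kroneckerTensor_apply, matMulTensor, doubleIndexEquiv, Equiv.trans_apply,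
    Equiv.prodProdProdComm_apply, Equiv.prodCongr_apply, Prod.map_apply,
    EmbeddingLike.apply_eq_iff_eq, Prod.mk.injEq]
  by_cases h₁ : a₁ = b₁ <;> by_cases h₂ : b₂ = c₁ <;> by_cases h₃ : a₂ = c₂ <;>
    by_cases h₁' : a₁' = b₁' <;> by_cases h₂' : b₂' = c₁' <;> by_cases h₃' : a₂' = c₂' <;>
    simp [h₁, h₂, h₃, h₁', h₂', h₃']

/-- **`R(⟨kk', mm', nn'⟩) ≤ R(⟨k,m,n⟩) · R(⟨k',m',n'⟩)`** (Bläser 2013, Lemma 5.8 with p. 24).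
[cite: Blaser2013, Lemma 5.8 and p. 24] -/
theorem Blaser2013_rank_matMulTensor_mul_le (k m n k' m' n' : ℕ) :
    tensorRank (matMulTensor K (k * k') (m * m') (n * n')) ≤
      tensorRank (matMulTensor K k m n) * tensorRank (matMulTensor K k' m' n') := by
  have h := tensorRank_reindex (doubleIndexEquiv k n k' n') (doubleIndexEquiv k m k' m')
    (doubleIndexEquiv m n m' n') (matMulTensor K (k * k') (m * m') (n * n'))
  rw [← h]
  have : (fun a b c => matMulTensor K (k * k') (m * m') (n * n') (doubleIndexEquiv k n k' n' a)
      (doubleIndexEquiv k m k' m' b) (doubleIndexEquiv m n m' n' c)) =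
      kroneckerTensor (matMulTensor K k m n) (matMulTensor K k' m' n') := by
    funext a b c
    rw [kroneckerTensor_matMulTensor]
  rw [this]
  exact Blaser2013_lemma58 _ _

end MatMul

/-- DISCHARGE of the named fact `Blaser2013RankSubmult` (`TensorRankFacts.lean`):
`R(⟨nm,nm,nm⟩) ≤ R(⟨n,n,n⟩) · R(⟨m,m,m⟩)` over every field. [cite: Blaser2013, Lemma 5.8] -/
theorem Blaser2013RankSubmult_holds : Blaser2013RankSubmult :=
  fun K _ n m => Blaser2013_rank_matMulTensor_mul_le K n n n m m m

/-- **Bläser 2013, Thm 5.9 in the cubic format**: if `R(⟨n,n,n⟩) ≤ r` (`n ≥ 2`) then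
`ω ≤ log_n r` (`= 3 log_{n³} r`; e.g. Strassen: `ω ≤ log₂ 7`). From the named fact `Blaser2013Thm59`.
[cite: Blaser2013, Thm. 5.9] -/
theorem omega_le_logb_of_rank_le' (h : Blaser2013Thm59) (K : Type) [Field K] {n r : ℕ} (hn : 2 ≤ n)
    (hr : tensorRank (matMulTensor K n n n) ≤ r) :
    omega K ≤ Real.logb n r := by
  have h3 := omega_le_of_rank_le h K hn hr
  have hcube : ((n * n * n : ℕ) : ℝ) = (n : ℝ) ^ 3 := by push_cast; ring
  rw [hcube, Real.logb, Real.log_pow] at h3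
  push_cast at h3
  rw [Real.logb]
  by_cases hl : Real.log n = 0
  · simp only [hl, mul_zero, div_zero] at h3 ⊢
    exact h3
  · calc omega K ≤ 3 * (Real.log r / (3 * Real.log n)) := h3
      _ = Real.log r / Real.log n := by
        rw [← mul_div_assoc, mul_div_mul_left _ _ (by norm_num : (3 : ℝ) ≠ 0)]

end Literature.Computability.AlgebraicComplexity

end
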